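import Summits.HubbardSuperconductivity.HubbardSuperconductivity.Theorems.ThermalWedgeTwTipContinuationAnchorDischarge
import Summits.HubbardSuperconductivity.HubbardSuperconductivity.Theorems.ChiralWindowCwThesisPenaltyResponseLRO
import Literature.Barriers.HubbardSuperconductivity.PureModelStripeCompetition
import HarnessLib

/-!
# `TwTipContinuation` (stmt-HubbardSuperconductivity-1700) in the hub's lattice of weak-coupling
# statements: cross-route sandwich

Route `ThermalWedge`, crux rank 6.  By `twTipContinuation_iff_uniformSummitWindow`
(`…Theorems.ThermalWedgeTwTipContinuationAnchorDischarge`, p85630) the crux is, in closed form, the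
`U`-UNIFORM WINDOW OF THE SUMMIT MATRIX at one doping of the wedge window:

  `TwTipContinuation ⟺ ∃ U₁ > 0, ∃ δ ∈ [1/10, 2/5], ∀ U ∈ (0, U₁], HasDWavePairFieldLROAt U δ`

(`Literature.Barriers.HubbardSuperconductivity.HasDWavePairFieldLROAt U δ` is the summit's matrix:
every admissible sequence of normalised `(N_L, S^z = 0)`-sector ground states of the pure torus
`hubbardTorus 2 L 1 U` has `d_{x²-y²}` pair-field long-range order along even sides; the summit is
`∃ U > 0, ∃ δ ∈ (0,1/2), HasDWavePairFieldLROAt U δ` by `Iff.rfl`).  This file places that closed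
form against the typed statements of the OTHER weak-coupling routes of the hub, by pure logic on top
of landed theorems (no new definition, no new analysis):

* `twTipContinuation_iff_summitMatrixWindow`, `twTipContinuation_iff_summitMatrixOpenWindow`,
  `twTipContinuation_iff_everyGSOrderOpenWindow` — the closed form under the catalogue name, with
  the half-open/open `U`-window made immaterial, and as a `U`-uniform every-ground-state order bound;
* DOWNWARD: `weakCouplingThesis_of_twTipContinuation` — the crux implies, word for word, the TARGET
  `WcbcsThesis` of route `WeakCouplingBCS` (stmt-HubbardSuperconductivity-2007; equal by `Iff.rfl` to
  the target `X` of route `TorusCooperLog`), and `largeNThesis_of_twTipContinuation` — the TARGET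
  `LargeNThesis` of route `IntrinsicLargeN` (stmt-HubbardSuperconductivity-1655): both are the same
  `U`-uniform window with the doping only required in `(0,1/2)`;
* UPWARD: `twTipContinuation_of_penaltyResponseWindow` — the canonical pair-penalty response
  `c·κ ≤ E_L(U;κ) − E_L(U;0)` (eventually along `L = 2(k+1)`) for all small `U` at ONE doping
  `δ ∈ [1/10,2/5]` implies the crux (via the landed support theorem
  `Theorems.CwThesis.stub_penaltyResponseLRO` = `TorusCooperLog.PenaltyResponseLRO`,
  stmt-HubbardSuperconductivity-10879); hence `twTipContinuation_of_klCanonical` — the crux follows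
  from the crux `KLCanonical` of route `TorusCooperLog` (stmt-HubbardSuperconductivity-2681) together
  with a Kohn–Luttinger `B₁g` datum at a doping INSIDE `[1/10,2/5]` (the datum `CertB1g`,
  stmt-HubbardSuperconductivity-2682, pins `δ` only in `(0,1/2)`; its suggested certificate window
  `[0.15,0.25]` lies inside the wedge window).

So, as typed, `TwTipContinuation` sits between `KLCanonical ∧ (B₁g datum in the wedge window)` and
the targets of `WeakCouplingBCS` / `TorusCooperLog` / `IntrinsicLargeN`; every one of these is the
weak-coupling `d`-wave superconductivity of the pure 2D Hubbard model, uniformly in `U ↓ 0`.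
Folklore logic; Scalapino, Phys. Rep. 250 (1995) §2 eq. (2.4) for the order functional. [folklore]
-/

noncomputable section

namespace Summit.HubbardSuperconductivity.TwTipContinuation.CrossRoute

open Matrix Filter Finset
open Literature.MathematicalPhysics.QuantumLattice Literature.Probability.LatticeModels
open Literature.Barriers.HubbardSuperconductivity (HasDWavePairFieldLROAt)
open Summit.HubbardSuperconductivity.HubbardSuperconductivity.Theses.ThermalWedge (TwTipContinuation)
open Summit.HubbardSuperconductivity.TwTipContinuation.AnchorDischarge
open scoped ComplexOrder

/-! ### The closed form under the catalogue name -/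

/-- **`TwTipContinuation` is the `U`-uniform window of the summit matrix**:
`TwTipContinuation ⟺ ∃U₁>0 ∃δ∈[1/10,2/5] ∀U∈(0,U₁], HasDWavePairFieldLROAt U δ`.  This is
`twTipContinuation_iff_uniformSummitWindow` with the summit matrix written under its catalogue name
(`HasDWavePairFieldLROAt`, definitionally the spelled-out conclusion). [folklore] -/
theorem twTipContinuation_iff_summitMatrixWindow :
    TwTipContinuation ↔
      ∃ U₁ : ℝ, 0 < U₁ ∧ ∃ δ ∈ Set.Icc (1 / 10 : ℝ) (2 / 5), ∀ U ∈ Set.Ioc (0 : ℝ) U₁,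
        HasDWavePairFieldLROAt U δ :=
  twTipContinuation_iff_uniformSummitWindow

/-- **Open `U`-window version**: `TwTipContinuation ⟺ ∃U₀>0 ∃δ∈[1/10,2/5] ∀U∈(0,U₀),
HasDWavePairFieldLROAt U δ` (half-open versus open window is immaterial: shrink `U₀` to `U₀/2`).
[folklore] -/
theorem twTipContinuation_iff_summitMatrixOpenWindow :
    TwTipContinuation ↔
      ∃ U₀ : ℝ, 0 < U₀ ∧ ∃ δ ∈ Set.Icc (1 / 10 : ℝ) (2 / 5), ∀ U ∈ Set.Ioo (0 : ℝ) U₀,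
        HasDWavePairFieldLROAt U δ := by
  rw [twTipContinuation_iff_summitMatrixWindow]
  constructor
  · rintro ⟨U₁, hU₁, δ, hδ, h⟩
    exact ⟨U₁, hU₁, δ, hδ, fun U hU => h U ⟨hU.1, hU.2.le⟩⟩
  · rintro ⟨U₀, hU₀, δ, hδ, h⟩
    refine ⟨U₀ / 2, half_pos hU₀, δ, hδ, fun U hU => h U ⟨hU.1, ?_⟩⟩
    exact lt_of_le_of_lt hU.2 (half_lt_self hU₀)

/-- **`TwTipContinuation` as a `U`-uniform every-ground-state order bound (open window)**:
`TwTipContinuation ⟺ ∃δ∈[1/10,2/5] ∃U₀>0 ∀U∈(0,U₀) ∃a>0 ∃L₀ ∀ even L ≥ L₀`, every normalised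
`(2⌊(1-δ)L²/2⌋, S^z=0)`-sector ground state `ψ` of `hubbardTorus 2 L 1 U` has
`a L⁴ ≤ re⟨ψ, Δ_d†Δ_d ψ⟩` — the matrix of `IntrinsicLargeN.LargeNThesis` with the doping pinned in
the wedge window. [folklore] -/
theorem twTipContinuation_iff_everyGSOrderOpenWindow :
    TwTipContinuation ↔
      ∃ δ ∈ Set.Icc (1 / 10 : ℝ) (2 / 5), ∃ U₀ : ℝ, 0 < U₀ ∧ ∀ U ∈ Set.Ioo (0 : ℝ) U₀,
        ∃ a : ℝ, 0 < a ∧ ∃ L₀ : ℕ, ∀ (L : ℕ) [NeZero L], L₀ ≤ L → Even L →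
          ∀ ψ : Fock (Orb (FermionTorus 2 L)), star ψ ⬝ᵥ ψ = 1 →
            IsGroundStateInSector (hubbardTorus 2 L 1 U) (2 * ⌊(1 - δ) * (L : ℝ) ^ 2 / 2⌋₊) 0 ψ →
              a * (L : ℝ) ^ 4 ≤
                (expect ((pairField dWaveFormFactor L)ᴴ * pairField dWaveFormFactor L) ψ).re := by
  rw [twTipContinuation_iff_everyGSOrder_window]
  constructor
  · rintro ⟨U₁, hU₁, δ, hδ, h⟩
    exact ⟨δ, hδ, U₁, hU₁, fun U hU => h U ⟨hU.1, hU.2.le⟩⟩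
  · rintro ⟨δ, hδ, U₀, hU₀, h⟩
    refine ⟨U₀ / 2, half_pos hU₀, δ, hδ, fun U hU => h U ⟨hU.1, ?_⟩⟩
    exact lt_of_le_of_lt hU.2 (half_lt_self hU₀)

/-! ### Downward: the crux implies the targets of `WeakCouplingBCS` / `TorusCooperLog` / `IntrinsicLargeN` -/

/-- **`TwTipContinuation` implies the target of route `WeakCouplingBCS`** (`WcbcsThesis`,
stmt-HubbardSuperconductivity-2007, body reproduced word for word; by `Iff.rfl` also the target `X`
of route `TorusCooperLog`): `∃U₀>0 ∃δ∈(0,1/2) ∀U∈(0,U₀), HasDWavePairFieldLROAt U δ`.  The crux is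
the same `U`-uniform window with the doping confined to `[1/10,2/5] ⊂ (0,1/2)`. [folklore] -/
theorem weakCouplingThesis_of_twTipContinuation :
    TwTipContinuation →
      ∃ U₀ : ℝ, 0 < U₀ ∧ ∃ δ ∈ Set.Ioo (0:ℝ) (1 / 2), ∀ U ∈ Set.Ioo (0:ℝ) U₀,
        Literature.Barriers.HubbardSuperconductivity.HasDWavePairFieldLROAt U δ := by
  intro h
  obtain ⟨U₀, hU₀, δ, hδ, hW⟩ := twTipContinuation_iff_summitMatrixOpenWindow.1 h
  exact ⟨U₀, hU₀, δ, ⟨by linarith [hδ.1], by linarith [hδ.2]⟩, hW⟩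

/-- **`TwTipContinuation` implies the target of route `IntrinsicLargeN`** (`LargeNThesis`,
stmt-HubbardSuperconductivity-1655, body reproduced word for word): a `U`-uniform every-ground-state
order bound `a L⁴ ≤ re⟨ψ, Δ_d†Δ_d ψ⟩` on a weak-coupling window at one doping `δ ∈ (0,1/2)`.
[folklore] -/
theorem largeNThesis_of_twTipContinuation :
    TwTipContinuation → ∃ U₀ : ℝ, 0 < U₀ ∧ ∃ δ ∈ Set.Ioo (0:ℝ) (1/2), ∀ U ∈ Set.Ioo (0:ℝ) U₀, (∃ a : ℝ, 0 < a ∧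
      ∃ L₀ : ℕ, ∀ (L : ℕ) [NeZero L], L₀ ≤ L → Even L →
        ∀ ψ : Literature.MathematicalPhysics.QuantumLattice.Fock
            (Literature.MathematicalPhysics.QuantumLattice.Orb
              (Literature.MathematicalPhysics.QuantumLattice.FermionTorus 2 L)),
          star ψ ⬝ᵥ ψ = 1 →
          Literature.MathematicalPhysics.QuantumLattice.IsGroundStateInSector
              (Literature.MathematicalPhysics.QuantumLattice.hubbardTorus 2 L 1 U)
              (2 * ⌊(1 - δ) * (L : ℝ) ^ 2 / 2⌋₊) 0 ψ →
            a * (L : ℝ) ^ 4 ≤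
              (Literature.MathematicalPhysics.QuantumLattice.expect
                ((Literature.MathematicalPhysics.QuantumLattice.pairField
                    Literature.MathematicalPhysics.QuantumLattice.dWaveFormFactor L)ᴴ *
                  Literature.MathematicalPhysics.QuantumLattice.pairField
                    Literature.MathematicalPhysics.QuantumLattice.dWaveFormFactor L) ψ).re) := by
  intro h
  obtain ⟨δ, hδ, U₀, hU₀, hW⟩ := twTipContinuation_iff_everyGSOrderOpenWindow.1 h
  exact ⟨U₀, hU₀, δ, ⟨by linarith [hδ.1], by linarith [hδ.2]⟩, hW⟩

/-! ### Upward: canonical pair-penalty response at one doping of the wedge window gives the crux -/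

/-- **Penalty response on a weak-coupling window implies `TwTipContinuation`.**  If at ONE doping
`δ ∈ [1/10,2/5]` there is `U₀ > 0` such that for every `U ∈ (0,U₀)` some penalty strength `κ > 0`
and `c > 0` give, eventually along the even sides `L = 2(k+1)`, the intensive response
`c·κ ≤ E_L(U;κ) − E_L(U;0)` with
`E_L(U;κ) = minEnergyOn (hubbardTorus 2 L 1 U + (κ/L⁴)·Δ_d†Δ_d) (szSector N_L 0)`,
`N_L = 2⌊(1-δ)L²/2⌋`, then the crux holds: `TorusCooperLog.PenaltyResponseLRO` (landed as
`Theorems.CwThesis.stub_penaltyResponseLRO`) turns each response into the summit matrix at `(U,δ)`,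
and `twTipContinuation_iff_summitMatrixOpenWindow` closes.  The `U`-dependence of `κ, c` is free
(they must in fact vanish as `U ↓ 0`, `…WeakCouplingDarkness.orderConstant_le`). [folklore] -/
theorem twTipContinuation_of_penaltyResponseWindow :
    (∃ δ ∈ Set.Icc (1 / 10 : ℝ) (2 / 5), ∃ U₀ : ℝ, 0 < U₀ ∧ ∀ U ∈ Set.Ioo (0 : ℝ) U₀,
      ∃ κ : ℝ, 0 < κ ∧ ∃ c : ℝ, 0 < c ∧ ∀ᶠ k : ℕ in Filter.atTop,
        c * κ ≤
          Matrix.minEnergyOn (hubbardTorus 2 (2 * (k + 1)) 1 U +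
              ((κ / ((2 * (k + 1) : ℕ) : ℝ) ^ 4 : ℝ) : ℂ) •
                ((pairField dWaveFormFactor (2 * (k + 1)))ᴴ * pairField dWaveFormFactor (2 * (k + 1))))
            (szSector (2 * ⌊(1 - δ) * ((2 * (k + 1) : ℕ) : ℝ) ^ 2 / 2⌋₊) 0) -
          Matrix.minEnergyOn (hubbardTorus 2 (2 * (k + 1)) 1 U)
            (szSector (2 * ⌊(1 - δ) * ((2 * (k + 1) : ℕ) : ℝ) ^ 2 / 2⌋₊) 0)) →
    TwTipContinuation := by
  rintro ⟨δ, hδ, U₀, hU₀, hresp⟩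
  refine twTipContinuation_iff_summitMatrixOpenWindow.2 ⟨U₀, hU₀, δ, hδ, fun U hU => ?_⟩
  obtain ⟨κ, hκ, c, hc, hev⟩ := hresp U hU
  exact Summit.HubbardSuperconductivity.HubbardSuperconductivity.Theorems.CwThesis.stub_penaltyResponseLRO
    U δ κ c hκ hc hev

/-- **`KLCanonical` plus a Kohn–Luttinger `B₁g` datum inside the wedge window imply
`TwTipContinuation`.**  `KLCanonical` (route `TorusCooperLog`, stmt-HubbardSuperconductivity-2681)
says: at every doping `δ ∈ (0,1/2)` at which the second-order pairing vertex has `B₁g` attractive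
(`channelInf … B1g ≤ −γU²`) and strictly leading every other `D₄` channel by `γU²` for all small `U`,
the canonical pair-penalty response holds on a weak-coupling window.  If such a datum is available
at some `δ ∈ [1/10,2/5]` (the datum item `CertB1g`, stmt-HubbardSuperconductivity-2682, asks for it
at some `δ ∈ (0,1/2)` and suggests certifying `δ ∈ [0.15,0.25] ⊂ [1/10,2/5]`), then
`twTipContinuation_of_penaltyResponseWindow` gives the crux.  Raghu–Kivelson–Scalapino, PRB 81
(2010) 224505 §III (the `B₁g` window at `t' = 0`, non-rigorous). [folklore] -/
theorem twTipContinuation_of_klCanonical :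
    Summit.HubbardSuperconductivity.HubbardSuperconductivity.Theses.TorusCooperLog.KLCanonical →
    (∃ δ ∈ Set.Icc (1 / 10 : ℝ) (2 / 5), ∃ γ U₁ : ℝ, 0 < γ ∧ 0 < U₁ ∧
      ∀ U ∈ Set.Ioo (0:ℝ) U₁,
        channelInf (squareDispersion 1 0) (chemicalPotentialOfDensity (squareDispersion 1 0) (1 - δ)) U
            D4Irrep.B1g ≤ -(γ * U ^ 2) ∧
          ∀ χ : D4Irrep, χ ≠ D4Irrep.B1g →
            channelInf (squareDispersion 1 0) (chemicalPotentialOfDensity (squareDispersion 1 0) (1 - δ)) U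
                D4Irrep.B1g + γ * U ^ 2 ≤
              channelInf (squareDispersion 1 0) (chemicalPotentialOfDensity (squareDispersion 1 0) (1 - δ))
                U χ) →
    TwTipContinuation := by
  rintro hKL ⟨δ, hδ, hd⟩
  have hδ' : δ ∈ Set.Ioo (0 : ℝ) (1 / 2) := ⟨by linarith [hδ.1], by linarith [hδ.2]⟩
  obtain ⟨U₀, hU₀, hresp⟩ := hKL δ hδ' hd
  exact twTipContinuation_of_penaltyResponseWindow ⟨δ, hδ, U₀, hU₀, hresp⟩

end Summit.HubbardSuperconductivity.TwTipContinuation.CrossRoute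

end
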